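import Mathlib
import HarnessLib
import Summits.HubbardSuperconductivity.HubbardSuperconductivity.Theorems.KLProgrammeKLRegimeSectorSliceIncrScaleForm
import Summits.HubbardSuperconductivity.HubbardSuperconductivity.Theorems.KLProgrammeKLRegimeEngineFlowPieceIncrementData

/-!
# KL programme — K3 ENGINE child (`KLRegimeEngineV17F2`, stmt-HubbardSuperconductivity-20437), stub (b) weighted lines, cure (c-D): the `m`-th INCREMENT
# of the weighted slice pair sums ON THE FLOW — `sliceIncrPairWt_charSum_l1_le_twoScale` between the consecutive flow frames `K_m → K_{m+1}`

Cell `gate-hubbard-kl`, seat hubbard-kl-k3c3-p2 (g9); v2 conditional token #19 `klWtBudget ↦ klWtBudget·klWtAllow`; located risk «(b)-Wt@j≥1», evidence #48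
CD-LIMITS.  The flow frame `K_n = −Σ_{m<n} p_m` has pieces with the (I-F) jets `‖Dⁱp_m‖ ≤ Gfr_i·uPow_i U·4^{(i−2)m}` (`FlowPieceJetsAt`), so the pair
`(K_m, K_{m+1})` lies in the two-scale class of `…SectorSliceIncrScaleForm` at depth `x = 4^m` with
`G_i = Gfr_i·uPow_i U` (`…EngineFlowPieceIncrementData.flowPiece_increment_data`) and the truncated band data of the partial frame
`‖De_{K_m}‖ ≤ 4 + (4/3)G₁`, `‖D²e_{K_m}‖ ≤ 16 + G₂·4^m`, `‖D³e_{K_m}‖ ≤ 64 + (G₃/3)·4^m` (`flowFrame_band_data`, geometric sums, `m ≤ 4^m`):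

* **`sliceIncrPairWt_flow_le`** — for every multiplier `M` with scale-form space data at the level `(Λ, Λ′]` and every `m` with the five threshold
  conditions (monotone in `m`: they hold from the first `m₀(j)` on) and the two `m`-free rate conditions:
  `Σ_z (1 + s₀|t| + (ρ/4^m)(|x₀|+|x₁|))·‖Ŝ^Δ_m(z)‖ ≤ 4^m·√(524288(1/s₀+1)[(1+4√2)²(2√2/ρ+2)(2√2/ρ₃+2) + (1/ρ+1)²])·√(24·2M·L²N_s)·2c₀K₁G₀/16^m`
  — net `∝ 4^{−m}` at the piece's own weight rate `ρ/4^m`; after the consumer's weight comparison (`× S4^m/ρ`) an `m`-FREE amount per piece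
  (CD-LIMITS §1: LINEAR in the piece count, the honest form of token #19's allowance).

Everything is proved; no definitions, no sorry.  Nothing asserts superconductivity.
-/

noncomputable section

namespace Summit.HubbardSuperconductivity.HubbardSuperconductivity.Theorems.EngineV8

set_option linter.dupNamespace false -- summit = problem name (single-conjunct summit), D-0017

open Real Finset Literature.MathematicalPhysics.QuantumLattice Literature.Probability.LatticeModels
open Summit.HubbardSuperconductivity.HubbardSuperconductivity.Theorems.DispersionFlow
open Summit.HubbardSuperconductivity.HubbardSuperconductivity.Theorems.KLRegimeSplit
open Summit.HubbardSuperconductivity.HubbardSuperconductivity.Theorems.TorusFourierL2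

/-! ## §1 Geometric sums of the piece jets below `m` -/

/-- `Σ_{m′<m} G·uPow·4^{(1−2)m′} ≤ (4/3)·G·uPow` (`G, uPow ≥ 0`). -/
theorem sum_jet_one_le {G u : ℝ} (hG : 0 ≤ G) (hu : 0 ≤ u) (m : ℕ) :
    ∑ m' ∈ range m, G * u * (4 : ℝ) ^ ((((1 : ℕ) : ℤ) - 2) * (m' : ℤ)) ≤ 4 / 3 * (G * u) := by
  have e : ∀ m' : ℕ, (4 : ℝ) ^ ((((1 : ℕ) : ℤ) - 2) * (m' : ℤ)) = (1 / 4 : ℝ) ^ m' := fun m' => by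
    rw [Nat.cast_one, show ((1 : ℤ) - 2) * (m' : ℤ) = -(m' : ℤ) by ring, zpow_neg, zpow_natCast, one_div, inv_pow]
  simp_rw [e, ← Finset.mul_sum]
  have hs : ∑ m' ∈ range m, (1 / 4 : ℝ) ^ m' ≤ 4 / 3 := by
    have h := geom_sum_Ico_le_of_lt_one (m := 0) (n := m) (by norm_num : (0 : ℝ) ≤ 1 / 4) (by norm_num)
    rw [← Finset.range_eq_Ico] at h
    refine h.trans ?_
    norm_num
  calc G * u * ∑ m' ∈ range m, (1 / 4 : ℝ) ^ m' ≤ G * u * (4 / 3) := mul_le_mul_of_nonneg_left hs (mul_nonneg hG hu)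
    _ = 4 / 3 * (G * u) := by ring

/-- `Σ_{m′<m} G·uPow·4^{(2−2)m′} = m·G·uPow ≤ G·uPow·4^m`. -/
theorem sum_jet_two_le {G u : ℝ} (hG : 0 ≤ G) (hu : 0 ≤ u) (m : ℕ) :
    ∑ m' ∈ range m, G * u * (4 : ℝ) ^ ((((2 : ℕ) : ℤ) - 2) * (m' : ℤ)) ≤ G * u * (4 : ℝ) ^ m := by
  have e : ∀ m' : ℕ, (4 : ℝ) ^ ((((2 : ℕ) : ℤ) - 2) * (m' : ℤ)) = 1 := fun m' => by
    rw [Nat.cast_ofNat, sub_self, zero_mul, zpow_zero]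
  simp_rw [e, mul_one, Finset.sum_const, card_range, nsmul_eq_mul]
  have hm : (m : ℝ) ≤ (4 : ℝ) ^ m := by exact_mod_cast (Nat.lt_pow_self (by norm_num : 1 < 4)).le
  calc (m : ℝ) * (G * u) ≤ (4 : ℝ) ^ m * (G * u) := mul_le_mul_of_nonneg_right hm (mul_nonneg hG hu)
    _ = G * u * (4 : ℝ) ^ m := by ring

/-- `Σ_{m′<m} G·uPow·4^{(3−2)m′} = G·uPow·(4^m − 1)/3 ≤ (G·uPow/3)·4^m`. -/
theorem sum_jet_three_le {G u : ℝ} (hG : 0 ≤ G) (hu : 0 ≤ u) (m : ℕ) :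
    ∑ m' ∈ range m, G * u * (4 : ℝ) ^ ((((3 : ℕ) : ℤ) - 2) * (m' : ℤ)) ≤ G * u / 3 * (4 : ℝ) ^ m := by
  have e : ∀ m' : ℕ, (4 : ℝ) ^ ((((3 : ℕ) : ℤ) - 2) * (m' : ℤ)) = (4 : ℝ) ^ m' := fun m' => by
    rw [show (((3 : ℕ) : ℤ) - 2) * (m' : ℤ) = (m' : ℤ) by push_cast; ring, zpow_natCast]
  simp_rw [e, ← Finset.mul_sum]
  rw [geom_sum_eq (by norm_num : (4 : ℝ) ≠ 1)]
  have h4 : 0 ≤ (4 : ℝ) ^ m := by positivity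
  calc G * u * (((4 : ℝ) ^ m - 1) / (4 - 1)) ≤ G * u * ((4 : ℝ) ^ m / 3) := by
        refine mul_le_mul_of_nonneg_left ?_ (mul_nonneg hG hu)
        rw [show (4 : ℝ) - 1 = 3 by norm_num]
        exact div_le_div_of_nonneg_right (by linarith) (by norm_num)
    _ = G * u / 3 * (4 : ℝ) ^ m := by ring

/-! ## §2 The increment on the flow -/

variable {L M : ℕ} [NeZero L] [NeZero M]

/-- **The `m`-th weighted slice pair increment ON THE FLOW** (see the module docstring): `sliceIncrPairWt_charSum_l1_le_twoScale` for the pair of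
consecutive flow frames `(K_m, K_{m+1})`, the piece and band data read off `FlowPieceJetsAt … R m′`, `m′ ≤ m`.  The two-scale parameters are
pinned: `G_i = Gfr_i·uPow_i U`, `b₁ = 4 + (4/3)G₁`, `b₂ = 16`, `b₂′ = G₂`, `b₃ = 64`, `b₃′ = G₃/3`, depth `4^m`. [cite: BenfattoGiulianiMastropietro2006, §3 (3.2)–(3.8)] -/
theorem sliceIncrPairWt_flow_le {β U μ Λ Λ' : ℝ} {R : RenConsts} {m : ℕ} (hβ : 0 < β) (hΛ : 0 < Λ) (hΛΛ' : Λ ≤ Λ')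
    (hM : Λ' < π * (2 * M - 5) / β) (hR : ∀ j, 0 ≤ R.Gfr j) (hJ : ∀ m' ≤ m, FlowPieceJetsAt L M β U μ R m')
    {G₀ G₁ G₂ G₃ b₁ b₂ b₂' b₃ b₃' : ℝ} (hG₀ : G₀ = R.Gfr 0 * uPow 0 U) (hG₁ : G₁ = R.Gfr 1 * uPow 1 U) (hG₂ : G₂ = R.Gfr 2 * uPow 2 U)
    (hG₃ : G₃ = R.Gfr 3 * uPow 3 U) (hb₁ : b₁ = 4 + 4 / 3 * (R.Gfr 1 * uPow 1 U)) (hb₂ : b₂ = 16) (hb₂' : b₂' = R.Gfr 2 * uPow 2 U)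
    (hb₃ : b₃ = 64) (hb₃' : b₃' = R.Gfr 3 * uPow 3 U / 3)
    {B₁ B₂ B₃ B₄ : ℝ} (hB₁ : ∀ x, |deriv salmhoferCutoff x| ≤ B₁) (hB₂ : ∀ x, |deriv (deriv salmhoferCutoff) x| ≤ B₂)
    (hB₃ : ∀ x, |deriv (deriv (deriv salmhoferCutoff)) x| ≤ B₃) (hB₄ : ∀ x, |deriv (deriv (deriv (deriv salmhoferCutoff))) x| ≤ B₄)
    (Mf : TorusSite 1 (2 * M) × TorusSite 2 L → ℂ) (hM0 : ∀ q, ‖Mf q‖ ≤ 1) {Ns : ℕ} (hsupp : (univ.filter fun q => Mf q ≠ 0).card ≤ Ns)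
    (v : Fin 2 → ℤ) (hv : v ≠ 0)
    {at₁ at₂ at₃ : ℝ} (hat₁ : 0 ≤ at₁) (hat₂ : 0 ≤ at₂) (hat₃ : 0 ≤ at₃)
    (hMt₁ : ∀ q, ‖fwdDiff ((fun _ : Fin 1 => (1 : ZMod (2 * M))), (0 : TorusSite 2 L)) Mf q‖ ≤ at₁)
    (hMt₂ : ∀ q, ‖(fwdDiff ((fun _ : Fin 1 => (1 : ZMod (2 * M))), (0 : TorusSite 2 L)))^[2] Mf q‖ ≤ at₂)
    (hMt₃ : ∀ q, ‖(fwdDiff ((fun _ : Fin 1 => (1 : ZMod (2 * M))), (0 : TorusSite 2 L)))^[3] Mf q‖ ≤ at₃)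
    {α₁ α₂ α₃ : ℝ} (hα₁ : 0 ≤ α₁) (hα₂ : 0 ≤ α₂) (hα₃ : 0 ≤ α₃)
    (hMe₁ : ∀ q (i : Fin 2), ‖fwdDiff ((0 : TorusSite 1 (2 * M)), (Pi.single i (1 : ZMod L) : TorusSite 2 L)) Mf q‖ ≤
      α₁ * ‖(WithLp.toLp 2 (fun j => 2 * π / L * ((Pi.single i (1 : ℤ) : Fin 2 → ℤ) j : ℝ)) : EuclideanSpace ℝ (Fin 2))‖)
    (hMe₂ : ∀ q (i : Fin 2), ‖(fwdDiff ((0 : TorusSite 1 (2 * M)), (Pi.single i (1 : ZMod L) : TorusSite 2 L)))^[2] Mf q‖ ≤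
      α₂ * ‖(WithLp.toLp 2 (fun j => 2 * π / L * ((Pi.single i (1 : ℤ) : Fin 2 → ℤ) j : ℝ)) : EuclideanSpace ℝ (Fin 2))‖ ^ 2)
    (hMe₃ : ∀ q (i : Fin 2), ‖(fwdDiff ((0 : TorusSite 1 (2 * M)), (Pi.single i (1 : ZMod L) : TorusSite 2 L)))^[3] Mf q‖ ≤
      α₃ * ‖(WithLp.toLp 2 (fun j => 2 * π / L * ((Pi.single i (1 : ℤ) : Fin 2 → ℤ) j : ℝ)) : EuclideanSpace ℝ (Fin 2))‖ ^ 3)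
    (hMn₁ : ∀ q, ‖fwdDiff ((0 : TorusSite 1 (2 * M)), (fun j => ((![-v 1, v 0] j : ℤ) : ZMod L))) Mf q‖ ≤
      α₁ * ‖(WithLp.toLp 2 (fun j => 2 * π / L * ((![-v 1, v 0] : Fin 2 → ℤ) j : ℝ)) : EuclideanSpace ℝ (Fin 2))‖)
    (hMn₂ : ∀ q, ‖(fwdDiff ((0 : TorusSite 1 (2 * M)), (fun j => ((![-v 1, v 0] j : ℤ) : ZMod L))))^[2] Mf q‖ ≤
      α₂ * ‖(WithLp.toLp 2 (fun j => 2 * π / L * ((![-v 1, v 0] : Fin 2 → ℤ) j : ℝ)) : EuclideanSpace ℝ (Fin 2))‖ ^ 2)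
    (hMn₃ : ∀ q, ‖(fwdDiff ((0 : TorusSite 1 (2 * M)), (fun j => ((![-v 1, v 0] j : ℤ) : ZMod L))))^[3] Mf q‖ ≤
      α₃ * ‖(WithLp.toLp 2 (fun j => 2 * π / L * ((![-v 1, v 0] : Fin 2 → ℤ) j : ℝ)) : EuclideanSpace ℝ (Fin 2))‖ ^ 3)
    (hMv₁ : ∀ q, ‖fwdDiff ((0 : TorusSite 1 (2 * M)), (fun j => ((v j : ℤ) : ZMod L))) Mf q‖ ≤
      α₁ * ‖(WithLp.toLp 2 (fun j => 2 * π / L * (v j : ℝ)) : EuclideanSpace ℝ (Fin 2))‖)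
    (hMv₂ : ∀ q, ‖(fwdDiff ((0 : TorusSite 1 (2 * M)), (fun j => ((v j : ℤ) : ZMod L))))^[2] Mf q‖ ≤
      α₂ * ‖(WithLp.toLp 2 (fun j => 2 * π / L * (v j : ℝ)) : EuclideanSpace ℝ (Fin 2))‖ ^ 2)
    (hMv₃ : ∀ q, ‖(fwdDiff ((0 : TorusSite 1 (2 * M)), (fun j => ((v j : ℤ) : ZMod L))))^[3] Mf q‖ ≤
      α₃ * ‖(WithLp.toLp 2 (fun j => 2 * π / L * (v j : ℝ)) : EuclideanSpace ℝ (Fin 2))‖ ^ 3)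
    {s₀ ρ ρ₃ k₁ k₂ k₃ k₄ : ℝ} (hs₀ : 0 < s₀) (hρ : 0 < ρ) (hρ₃ : 0 < ρ₃)
    (hk₁ : k₁ = (16 * B₁ + 16) / Λ ^ 2) (hk₂ : k₂ = (32 * B₂ + 144 * B₁ + 128) / Λ ^ 3)
    (hk₃ : k₃ = (64 * B₃ + 480 * B₂ + 1728 * B₁ + 1536) / Λ ^ 4)
    (hk₄ : k₄ = (128 * B₄ + 1408 * B₃ + 7776 * B₂ + 27648 * B₁ + 24576) / Λ ^ 5)
    (ht : (2 * π / β) ^ 3 * ((128 * B₄ + 1216 * B₃ + 6912 * B₂ + 26112 * B₁ + 24576) * (β * (L : ℝ) ^ 2) / Λ ^ 5) +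
          3 * (at₁ * ((2 * π / β) ^ 2 * ((64 * B₃ + 416 * B₂ + 1600 * B₁ + 1536) * (β * (L : ℝ) ^ 2) / Λ ^ 4))) +
          3 * (at₂ * ((2 * π / β) * ((32 * B₂ + 128 * B₁ + 128) * (β * (L : ℝ) ^ 2) / Λ ^ 3))) + at₃ * ((16 * B₁ + 16) * (β * (L : ℝ) ^ 2) / Λ ^ 2) ≤
      2 * ((16 * B₁ + 16) * (β * (L : ℝ) ^ 2) / Λ ^ 2) * (4 / (s₀ * (2 * M : ℕ))) ^ 3)
    (hX1 : 3 * (3 * G₁ * k₂ * b₂' + 3 * G₂ * k₁ * α₁ + 3 * G₂ * k₂ * b₁) ≤ k₁ * G₃ * (4 : ℝ) ^ m)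
    (hX2 : 3 * (3 * G₀ * k₂ * α₁ * b₂' + 3 * G₀ * k₃ * b₁ * b₂' + 6 * G₁ * k₂ * α₁ * b₁ + 3 * G₁ * k₃ * b₁ ^ 2 + G₀ * G₃ * k₂ + G₀ * k₂ * b₃' + 3 * G₁ * G₂ * k₂ + 3 * G₁ * k₁ * α₂ + 3 * G₁ * k₂ * b₂) ≤ k₁ * G₃ * ((4 : ℝ) ^ m) ^ 2)
    (hX3 : 3 * ((3 * G₀ * k₃ * α₁ * b₁ ^ 2 + G₀ * k₄ * b₁ ^ 3 + 3 * G₀ * G₁ * k₃ * b₂' + 3 * G₀ * G₂ * k₂ * α₁ + 3 * G₀ * G₂ * k₃ * b₁ + 3 * G₀ * k₂ * α₁ * b₂ + 3 * G₀ * k₂ * α₂ * b₁ + 3 * G₀ * k₃ * b₁ * b₂ + 3 * G₁ ^ 2 * k₂ * α₁ + 3 * G₁ ^ 2 * k₃ * b₁ + G₀ * k₁ * α₃ + G₀ * k₂ * b₃) + (6 * G₀ * G₁ * k₃ * α₁ * b₁ + 3 * G₀ * G₁ * k₄ * b₁ ^ 2 + 3 * G₀ * G₁ * G₂ * k₃ +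 3 * G₀ * G₁ * k₂ * α₂ + 3 * G₀ * G₁ * k₃ * b₂ + G₁ ^ 3 * k₃) + (3 * G₀ * G₁ ^ 2 * k₃ * α₁ + 3 * G₀ * G₁ ^ 2 * k₄ * b₁) + (G₀ * G₁ ^ 3 * k₄)) ≤
      k₁ * G₃ * ((4 : ℝ) ^ m) ^ 3)
    (hY1 : 2 * (G₀ * k₂ * b₂' + 2 * G₁ * k₁ * α₁ + 2 * G₁ * k₂ * b₁) ≤ k₁ * G₂ * (4 : ℝ) ^ m)
    (hY2 : 2 * ((2 * G₀ * k₂ * α₁ * b₁ + G₀ * k₃ * b₁ ^ 2 + G₀ * G₂ * k₂ + G₀ * k₁ * α₂ + G₀ * k₂ * b₂ + G₁ ^ 2 * k₂) + (2 * G₀ * G₁ * k₂ * α₁ + 2 * G₀ * G₁ * k₃ * b₁) + (G₀ * G₁ ^ 2 * k₃)) ≤ k₁ * G₂ * ((4 : ℝ) ^ m) ^ 2)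
    (hrate₃ : G₃ * ρ ^ 3 ≤ (2 / π) ^ 3 * G₀) (hrate₂ : G₂ * ρ₃ ^ 2 ≤ (2 / π) ^ 2 * G₀) :
    ∑ z : TorusSite 1 (2 * M) × TorusSite 2 L,
        (1 + s₀ * |(((z.1 0).valMinAbs : ℤ) : ℝ)| + ρ / (4 : ℝ) ^ m * |(((z.2 0).valMinAbs : ℤ) : ℝ)| + ρ / (4 : ℝ) ^ m * |(((z.2 1).valMinAbs : ℤ) : ℝ)|) *
        ‖∑ q : TorusSite 1 (2 * M) × TorusSite 2 L, (torusChar q.1 z.1 * torusChar q.2 z.2) •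
          ((((1 / (β * (L : ℝ) ^ 2) : ℝ) : ℂ) ^ 2 *
            (Mf q * (sliceSymbolFnXi (β * (L : ℝ) ^ 2) 0 Λ Λ' (matsubaraFreq β M ⟨(q.1 0).val, ZMod.val_lt (q.1 0)⟩)
                (nambuXiCT L μ (klFlowFrameU L M β U μ (m + 1)) q.2) -
              sliceSymbolFnXi (β * (L : ℝ) ^ 2) 0 Λ Λ' (matsubaraFreq β M ⟨(q.1 0).val, ZMod.val_lt (q.1 0)⟩)
                (nambuXiCT L μ (klFlowFrameU L M β U μ m) q.2)))))‖ ≤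
      (4 : ℝ) ^ m * Real.sqrt (524288 * (1 / s₀ + 1) * ((1 + 4 * Real.sqrt 2) ^ 2 * ((2 * Real.sqrt 2 / ρ + 2) * (2 * Real.sqrt 2 / ρ₃ + 2)) + (1 / ρ + 1) ^ 2)) *
        Real.sqrt (24 * (2 * M : ℕ) * (L : ℝ) ^ 2 * Ns) * (2 * ((1 / (β * (L : ℝ) ^ 2)) ^ 2 * ((16 * B₁ + 16) * (β * (L : ℝ) ^ 2) / Λ ^ 2 * (G₀ / ((4 : ℝ) ^ m) ^ 2)))) := by
  have hx : (1 : ℝ) ≤ (4 : ℝ) ^ m := one_le_pow₀ (by norm_num)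
  have hx0 : (0 : ℝ) < (4 : ℝ) ^ m := by positivity
  have hu : ∀ j, 0 ≤ uPow j U := fun j => by unfold uPow; split_ifs <;> positivity
  -- the piece data
  obtain ⟨hv₀, hv₁, hv₂, hv₃⟩ := flowPiece_increment_data (L := L) (M := M) (hJ m le_rfl)
  have e0 : (4 : ℝ) ^ ((((0 : ℕ) : ℤ) - 2) * (m : ℤ)) = 1 / ((4 : ℝ) ^ m) ^ 2 := by
    rw [Nat.cast_zero, zero_sub, show (-2 : ℤ) * (m : ℤ) = -((m * 2 : ℕ) : ℤ) by push_cast; ring, zpow_neg, zpow_natCast, pow_mul,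
      one_div]
  have e1 : (4 : ℝ) ^ ((((1 : ℕ) : ℤ) - 2) * (m : ℤ)) = 1 / (4 : ℝ) ^ m := by
    rw [Nat.cast_one, show ((1 : ℤ) - 2) * (m : ℤ) = -(m : ℤ) by ring, zpow_neg, zpow_natCast, one_div]
  have e2 : (4 : ℝ) ^ ((((2 : ℕ) : ℤ) - 2) * (m : ℤ)) = 1 := by rw [Nat.cast_ofNat, sub_self, zero_mul, zpow_zero]
  have e3 : (4 : ℝ) ^ ((((3 : ℕ) : ℤ) - 2) * (m : ℤ)) = (4 : ℝ) ^ m := by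
    rw [show (((3 : ℕ) : ℤ) - 2) * (m : ℤ) = (m : ℤ) by push_cast; ring, zpow_natCast]
  have hv₀' : ∀ p : Momentum, |frameLevel μ (klFlowFrameU L M β U μ (m + 1)) p - frameLevel μ (klFlowFrameU L M β U μ m) p| ≤
      G₀ / ((4 : ℝ) ^ m) ^ 2 := fun p => (hv₀ p).trans_eq (by rw [e0, hG₀]; ring)
  have hv₁' : ∀ p : Momentum, ‖fderiv ℝ (fun q : Momentum => frameLevel μ (klFlowFrameU L M β U μ (m + 1)) q -
      frameLevel μ (klFlowFrameU L M β U μ m) q) p‖ ≤ G₁ / (4 : ℝ) ^ m := fun p => (hv₁ p).trans_eq (by rw [e1, hG₁]; ring)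
  have hv₂' : ∀ p : Momentum, ‖iteratedFDeriv ℝ 2 (fun q : Momentum => frameLevel μ (klFlowFrameU L M β U μ (m + 1)) q -
      frameLevel μ (klFlowFrameU L M β U μ m) q) p‖ ≤ G₂ := fun p => (hv₂ p).trans_eq (by rw [e2, hG₂, mul_one])
  have hv₃' : ∀ p : Momentum, ‖iteratedFDeriv ℝ 3 (fun q : Momentum => frameLevel μ (klFlowFrameU L M β U μ (m + 1)) q -
      frameLevel μ (klFlowFrameU L M β U μ m) q) p‖ ≤ G₃ * (4 : ℝ) ^ m := fun p => (hv₃ p).trans_eq (by rw [e3, hG₃])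
  -- the band data of the partial frame
  obtain ⟨hd₁, hd₂, hd₃⟩ := flowFrame_band_data (L := L) (M := M) (β := β) (U := U) (μ := μ) (R := R) (m := m)
    (fun m' hm' => hJ m' hm'.le)
  have hb₁' : ∀ p : Momentum, ‖fderiv ℝ (frameLevel μ (klFlowFrameU L M β U μ m)) p‖ ≤ b₁ := fun p =>
    (hd₁ p).trans (by rw [hb₁, pow_one]; exact add_le_add le_rfl (sum_jet_one_le (hR 1) (hu 1) m))
  have hb₂'' : ∀ p : Momentum, ‖iteratedFDeriv ℝ 2 (frameLevel μ (klFlowFrameU L M β U μ m)) p‖ ≤ b₂ + b₂' * (4 : ℝ) ^ m := fun p =>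
    (hd₂ p).trans (by
      rw [hb₂, hb₂', show ((4 : ℝ) ^ (2 : ℕ)) = 16 by norm_num]
      exact add_le_add le_rfl (sum_jet_two_le (hR 2) (hu 2) m))
  have hb₃'' : ∀ p : Momentum, ‖iteratedFDeriv ℝ 3 (frameLevel μ (klFlowFrameU L M β U μ m)) p‖ ≤ b₃ + b₃' * (4 : ℝ) ^ m := fun p =>
    (hd₃ p).trans (by
      rw [hb₃, hb₃', show ((4 : ℝ) ^ (3 : ℕ)) = 64 by norm_num]
      exact add_le_add le_rfl (sum_jet_three_le (hR 3) (hu 3) m))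
  have hG₂0 : 0 ≤ G₂ := by rw [hG₂]; exact mul_nonneg (hR 2) (hu 2)
  have hG₃0 : 0 ≤ G₃ := by rw [hG₃]; exact mul_nonneg (hR 3) (hu 3)
  have hb₂0 : 0 ≤ b₂ := by rw [hb₂]; norm_num
  have hb₂'0 : 0 ≤ b₂' := by rw [hb₂']; exact mul_nonneg (hR 2) (hu 2)
  have hb₃0 : 0 ≤ b₃ := by rw [hb₃]; norm_num
  have hb₃'0 : 0 ≤ b₃' := by rw [hb₃']; exact div_nonneg (mul_nonneg (hR 3) (hu 3)) (by norm_num)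
  exact sliceIncrPairWt_charSum_l1_le_twoScale hβ hΛ hΛΛ' hM hx hG₂0 hG₃0 hb₂0 hb₂'0 hb₃0 hb₃'0 hb₁' hb₂'' hb₃'' hv₀' hv₁' hv₂' hv₃'
    hB₁ hB₂ hB₃ hB₄ Mf hM0 hsupp v hv hat₁ hat₂ hat₃ hMt₁ hMt₂ hMt₃ hα₁ hα₂ hα₃ hMe₁ hMe₂ hMe₃ hMn₁ hMn₂ hMn₃ hMv₁ hMv₂ hMv₃
    hs₀ hρ hρ₃ hk₁ hk₂ hk₃ hk₄ ht hX1 hX2 hX3 hY1 hY2 hrate₃ hrate₂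

end Summit.HubbardSuperconductivity.HubbardSuperconductivity.Theorems.EngineV8

end
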